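import Literature.Geometry.Lorentzian.CarterFarEnvelope
import Literature.Geometry.Lorentzian.TeukolskyRadialSchrodingerForm
import HarnessLib

/-!
# Far-zone sup bound for ANY solution of the scalar radial Teukolsky equation from its data at one
# large radius (Sonin's theorem on `r ≥ max(7M, √(12Λ)/|ω|, 1/(Mω²))`)
(namespace `Literature.Geometry.Lorentzian.Kerr`.)

Companion of `CarterFarEnvelope.lean` (which treats the solution with `𝓘⁺` data, moving INWARD).
Here the direction is OUTWARD and the solution arbitrary: in the tortoise variable Carter's
equation reads `u″ + (ω² − V(ρ x))u = 0` (`u = √(r² + a²) R`, `Kerr.schrodingerForm`), and on the far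
region `r ≥ R_far := max(7M, √(12Λ)/|ω|, 1/(Mω²))` the coefficient satisfies `ω² − V ≥ ω²/2 > 0`
(`Kerr.half_sq_le_omega_sq_sub_sepPotential`) and is non-decreasing along `r*`
(`dV/dr < 0` for `r ≥ 7M`, `Kerr.deriv_sepPotential_neg_of_seven_mul_le`). By Sonin's theorem
(`Literature.Analysis.ODE.norm_sq_le_soninEnvelope_of_le`: the envelope `‖u‖² + ‖u′‖²/(ω² − V)` is
non-increasing in the direction of increasing coefficient) the amplitude beyond any far radius `r₀`
is controlled by the data at `r₀`:

* `far_weightedNormSq_le` — for a classical solution `R` of the scalar radial Teukolsky ODE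
  (`λ = Λ − a²ω²`, `|a| < M`, `ω ≠ 0`, admissible `(ω, m, Λ)`) and `R_far ≤ r₀ ≤ r`:
  `(r² + a²)‖R r‖² ≤ (r₀² + a²)‖R r₀‖² + 2·((Δ/(r₀² + a²))‖d/dr[√(r² + a²)R](r₀)‖)²/ω²`
  (the second datum is `‖u′‖` at `r₀`, `′ = d/dr*`).

Stated in the `r`-variable (no tortoise function in the statement); the tortoise radius is
introduced and eliminated inside the proof (`Kerr.exists_isTortoiseRadius`,
`IsTortoiseRadius.exists_apply_eq`). Used for the polynomial sup bound of the horizon-normalised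
solution on sub-extremal Kerr (crux `KappaExplicitWaveDecay`, stub `stub_horizonSupBoxPoly`).

## References
* M. Dafermos, I. Rodnianski, Y. Shlapentokh-Rothman, arXiv:1402.7034 = Ann. of Math. 183 (2016),
  §5.2.3, §8.4 (Prop. 8.4.1); key `DafermosRodnianskiShlapentokhrothman2014`.
* G. Szegő, *Orthogonal Polynomials*, §7.31 (Sonin's monotonicity theorem).
-/

noncomputable section

open Filter Set
open scoped _root_.Topology

namespace Literature.Geometry.Lorentzian

namespace Kerr

/-- `R_far = max(7M, √(12Λ)/|ω|, 1/(Mω²))` lies beyond the horizon radius: `r₊ ≤ 2M < 7M ≤ R_far`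
(`0 < M`). [folklore] -/
theorem rPlus_lt_of_farRadius_le {M a ω Λ r₀ : ℝ} (hM : 0 < M)
    (hr₀ : max (7 * M) (max (Real.sqrt (12 * Λ) / |ω|) (1 / (M * ω ^ 2))) ≤ r₀) :
    rPlus M a < r₀ := by
  have h7 : 7 * M ≤ r₀ := le_of_max_le_left hr₀
  have h2 : rPlus M a ≤ 2 * M := rPlus_le_two_mul_self hM.le a
  linarith

/-- **Far-zone sup bound from the data at one far radius (Sonin's theorem, outward).** Let
`0 < M`, `|a| < M`, `ω ≠ 0`, `(ω, m, Λ)` admissible, and let `R` be a classical solution of the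
scalar radial Teukolsky ODE with `λ = Λ − a²ω²`. If
`max(7M, √(12Λ)/|ω|, 1/(Mω²)) ≤ r₀ ≤ r` then
`(√(r² + a²)‖R r‖)² ≤ (√(r₀² + a²)‖R r₀‖)² + 2((Δ(r₀)/(r₀² + a²))‖(√(·² + a²)R)′(r₀)‖)²/ω²`:
along a tortoise radius `ρ`, `u = √(ρ² + a²)R∘ρ` solves `u″ + (ω² − V∘ρ)u = 0` with
`u′ = (Δ/(r² + a²))d/dr[√(r² + a²)R]` (`Kerr.schrodingerForm`); on `ρ ≥ r₀` the coefficient is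
`≥ ω²/2 > 0` and non-decreasing, so `‖u‖² ≤ ‖u(x₀)‖² + ‖u′(x₀)‖²/(ω² − V(r₀))`
(`norm_sq_le_soninEnvelope_of_le`). [cite: DafermosRodnianskiShlapentokhrothman2014, Prop. 8.4.1 (proof)] -/
theorem far_weightedNormSq_le {M a ω Λ : ℝ} {m : ℤ} (hM : 0 < M) (ha : |a| < M) (hω : ω ≠ 0)
    (hadm : IsAdmissibleTriple a ω m Λ) {R : ℝ → ℂ}
    (hR : IsRadialTeukolskySolution M a 0 ω m (Λ - a ^ 2 * ω ^ 2) R) {r₀ r : ℝ}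
    (hr₀ : max (7 * M) (max (Real.sqrt (12 * Λ) / |ω|) (1 / (M * ω ^ 2))) ≤ r₀) (hr : r₀ ≤ r) :
    (Real.sqrt (r ^ 2 + a ^ 2) * ‖R r‖) ^ 2 ≤
      (Real.sqrt (r₀ ^ 2 + a ^ 2) * ‖R r₀‖) ^ 2 +
        2 * (delta M a r₀ / (r₀ ^ 2 + a ^ 2) *
          ‖deriv (fun s : ℝ ↦ ((Real.sqrt (s ^ 2 + a ^ 2) : ℝ) : ℂ) * R s) r₀‖) ^ 2 / ω ^ 2 := by
  have hsub : IsSubextremal M a := ha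
  have h7 : 7 * M ≤ r₀ := le_of_max_le_left hr₀
  have hrp : rPlus M a < r₀ := rPlus_lt_of_farRadius_le hM hr₀
  -- tortoise variable: `ρ x₀ = r₀`, `ρ x = r`, `x₀ ≤ x`
  obtain ⟨ρ, hρ⟩ := exists_isTortoiseRadius hsub
  obtain ⟨x₀, hx₀⟩ := hρ.exists_apply_eq hrp
  obtain ⟨x, hx⟩ := hρ.exists_apply_eq (hrp.trans_le hr)
  have hxx : x₀ ≤ x := (hρ.le_iff_le hsub).1 (by rw [hx₀, hx]; exact hr)
  -- Carter's equation for `u = √(ρ² + a²) R ∘ ρ`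
  obtain ⟨u₁, u₂, hu⟩ := schrodingerForm hM ha hR hρ
  set u : ℝ → ℂ := fun y ↦ ((Real.sqrt (ρ y ^ 2 + a ^ 2) : ℝ) : ℂ) * R (ρ y) with hu_def
  set φ : ℝ → ℝ := fun y ↦ ω ^ 2 - sepPotential M a ω m Λ (ρ y) with hφ_def
  set φ' : ℝ → ℝ := fun y ↦
    -(deriv (sepPotential M a ω m Λ) (ρ y) * (delta M a (ρ y) / (ρ y ^ 2 + a ^ 2))) with hφ'_def
  have hdata : ∀ s ∈ Icc x₀ x, HasDerivAt u (u₁ s) s ∧ HasDerivAt u₁ (-(φ s : ℂ) * u s) s ∧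
      HasDerivAt φ (φ' s) s := by
    intro s _
    obtain ⟨h1, h2, h3, -⟩ := hu s
    refine ⟨h1, ?_, hρ.hasDerivAt_omega_sq_sub_sepPotential hsub ω m Λ s⟩
    have e : u₂ s = -(φ s : ℂ) * u s := by
      rw [neg_mul]
      exact eq_neg_of_add_eq_zero_left h3
    rw [← e]
    exact h2
  -- on `[x₀, x]`: `ρ ≥ r₀`, so the coefficient is `≥ ω²/2 > 0` and non-decreasing
  have hfar : ∀ s ∈ Icc x₀ x,
      max (7 * M) (max (Real.sqrt (12 * Λ) / |ω|) (1 / (M * ω ^ 2))) ≤ ρ s := fun s hs ↦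
    hr₀.trans (by rw [← hx₀]; exact (hρ.strictMono hsub).monotone hs.1)
  have hω2 : 0 < ω ^ 2 := by positivity
  have hφpos : ∀ s ∈ Icc x₀ x, 0 < φ s := fun s hs ↦
    (half_pos hω2).trans_le (half_sq_le_omega_sq_sub_sepPotential hsub hω hadm (hfar s hs))
  have hφ' : ∀ s ∈ Icc x₀ x, 0 ≤ φ' s := by
    intro s hs
    have h7s : 7 * M ≤ ρ s := (le_max_left _ _).trans (hfar s hs)
    have hV : deriv (sepPotential M a ω m Λ) (ρ s) < 0 :=
      deriv_sepPotential_neg_of_seven_mul_le hsub hadm h7s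
    have hρ' : 0 < delta M a (ρ s) / (ρ s ^ 2 + a ^ 2) := hρ.deriv_pos hsub s
    simp only [hφ'_def]
    nlinarith [mul_neg_of_neg_of_pos hV hρ']
  have key := Literature.Analysis.ODE.norm_sq_le_soninEnvelope_of_le hdata hφpos hφ'
    (left_mem_Icc.2 hxx) (right_mem_Icc.2 hxx) hxx
  -- `‖u′ x₀‖²/φ(x₀) ≤ 2‖u′ x₀‖²/ω²`
  have hφ0 : ω ^ 2 / 2 ≤ φ x₀ :=
    half_sq_le_omega_sq_sub_sepPotential hsub hω hadm (hfar x₀ (left_mem_Icc.2 hxx))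
  have hdiv : ‖u₁ x₀‖ ^ 2 / φ x₀ ≤ 2 * ‖u₁ x₀‖ ^ 2 / ω ^ 2 := by
    rw [div_le_div_iff₀ ((half_pos hω2).trans_le hφ0) hω2]
    nlinarith [sq_nonneg ‖u₁ x₀‖]
  -- back to `R`: `‖u‖ = √(r² + a²)‖R‖`, `u′ = (Δ/(r² + a²))·d/dr[√(r² + a²)R]`
  have hnorm : ∀ y, ‖u y‖ = Real.sqrt (ρ y ^ 2 + a ^ 2) * ‖R (ρ y)‖ := fun y ↦ by
    simp only [hu_def, norm_mul, Complex.norm_of_nonneg (Real.sqrt_nonneg _)]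
  have hu₁ : ‖u₁ x₀‖ = delta M a r₀ / (r₀ ^ 2 + a ^ 2) *
      ‖deriv (fun s : ℝ ↦ ((Real.sqrt (s ^ 2 + a ^ 2) : ℝ) : ℂ) * R s) r₀‖ := by
    rw [(hu x₀).2.2.2, norm_mul, Complex.norm_of_nonneg (hρ.deriv_pos hsub x₀).le, hx₀]
  rw [← hx, ← hnorm x, ← hu₁]
  have h0 := hnorm x₀
  rw [hx₀] at h0
  rw [← h0]
  exact key.trans (by linarith)

end Kerr

end Literature.Geometry.Lorentzian

end
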